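import Mathlib
import HarnessLib
import Summits.HubbardSuperconductivity.HubbardSuperconductivity.Theorems.KLProgrammeKLRegimeWickCrossIterate

/-!
# Route `KLProgramme` — crux K3, gen-4/5 ENGINE child (stmt-HubbardSuperconductivity-19855 / its V14 successor), (E2-v9):
# the MIXED double cross contraction and the RUNG DECOMPOSITION of the second-order Wick term (cell gate-hubbard-kl, seat p1 g8)

Sequel to p485455 (`…WickCrossIterate`: `Δ_×(C)²`) and p484175 (`klw_wickAction_succ_cross`).  The second-order Wick term of the step is
`−½·dblFold((e^{Δ_×(g)} − 1)(e^{Δ_×(D)}(𝒲⁰𝒲¹)))` (`g` the slice, `D` the new soft covariance).  Expanding both exponentials to second order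
in the cross Laplacians, the TWO-LINE part — the bubbles — is `½Δ_×(g)² + Δ_×(g)Δ_×(D)` = line pairs `g⊗g` (weight ½·2 orderings) and `g⊗D`,
i.e. exactly the FULL rung of the step (E2-RUNG-WEIGHT-NOTE / E2-STRUCTURE-NOTE §4).  This file supplies the algebra for reading it:

* §1 **`grassmannLaplacian_crossCov_crossCov_copy_mul_copy`** — the mixed double contraction for two covariances `C₁, C₂`:
  `Δ_×(C₁)(Δ_×(C₂)(a⁰·b¹)) = −Σ_{X,Y,X',Y'} contr C₂ X Y · contr C₁ X' Y' • (∂_{X'}∂_X a)⁰ · (∂_{Y'}∂_Y b)¹` (all `a, b`);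
* §2 `crossCov` is linear (`crossCov_smul`, with `crossCov_add` of p484175), hence **`grassmannLaplacian_crossCov_add`** and the binomial
  **`grassmannLaplacian_crossCov_add_sq`**: `Δ_×(D+g)² − Δ_×(D)² = Δ_×(g)² + Δ_×(g)Δ_×(D) + Δ_×(D)Δ_×(g)` as operators (they commute:
  `commute_grassmannLaplacian`) — the two-line part of `e^{Δ_×(D+g)} − e^{Δ_×(D)}` carries the line pairs `g⊗g + g⊗D + D⊗g` and no `D⊗D`;
* §3 the model reading **`klw_rung_pairs`**: with `D = D_{n+1}`, `g = g_{n+1}`, `D_n = D + g`: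
  `Δ_×(D_n)² − Δ_×(D_{n+1})² = Δ_×(g_{n+1})² + Δ_×(g_{n+1})∘Δ_×(D_{n+1}) + Δ_×(D_{n+1})∘Δ_×(g_{n+1})`.

Exact algebra; no definitions; nothing about sizes is asserted.
-/

noncomputable section

namespace Summit.HubbardSuperconductivity.HubbardSuperconductivity.Theorems.KLRegimeWick

set_option linter.dupNamespace false -- summit = problem name (single-conjunct summit), D-0017

open Literature.MathematicalPhysics.QuantumLattice Literature.Probability.LatticeModels GrassmannAlgebra Finset Matrix
open Summit.HubbardSuperconductivity.HubbardSuperconductivity.Theorems.KLProgrammeLegKernels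
open Summit.HubbardSuperconductivity.HubbardSuperconductivity.Theorems.KLRegimeSplit

section Generic

variable (R : Type*) [CommRing R] [Algebra ℚ R] {Γ : Type*} [Fintype Γ] [DecidableEq Γ]

/-! ## §1 The mixed double cross contraction -/

/-- **The mixed double cross contraction**: for all `a, b` and covariances `C₁, C₂`,
`Δ_{×C₁} (Δ_{×C₂} (a⁰·b¹)) = −Σ_X Σ_Y Σ_X' Σ_Y' (contr C₂ X Y · contr C₁ X' Y') • ((∂_{X'}∂_X a)⁰ · (∂_{Y'}∂_Y b)¹)`. -/
theorem grassmannLaplacian_crossCov_crossCov_copy_mul_copy (C₁ C₂ : Matrix Γ Γ R) (a b : GrassmannAlgebra R Γ) :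
    grassmannLaplacian R (crossCov R C₁) (grassmannLaplacian R (crossCov R C₂) (dblCopy R 0 a * dblCopy R 1 b)) =
      -∑ X, ∑ Y, ∑ X', ∑ Y', (contr R C₂ X Y * contr R C₁ X' Y') •
        (dblCopy R 0 (grassmannDeriv R X' (grassmannDeriv R X a)) *
          dblCopy R 1 (grassmannDeriv R Y' (grassmannDeriv R Y b))) := by
  rw [grassmannLaplacian_crossCov_copy_mul_copy, map_sum]
  simp only [map_sum, map_smul, grassmannLaplacian_crossCov_copy_mul_copy, involute_grassmannDeriv_involute, map_neg,
    neg_mul, smul_neg, Finset.sum_neg_distrib, smul_sum, smul_smul]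

/-! ## §2 Linearity of the cross covariance and the two-line binomial -/

omit [Fintype Γ] [DecidableEq Γ] [Algebra ℚ R] in
/-- `dblCov` is homogeneous in the covariance. -/
theorem dblCov_smul (r : R) (C : Matrix Γ Γ R) (s t : Fin 2) : dblCov R (r • C) s t = r • dblCov R C s t := by
  ext p q
  simp only [dblCov_apply, Matrix.smul_apply, smul_eq_mul]
  split_ifs <;> simp

omit [Fintype Γ] [DecidableEq Γ] [Algebra ℚ R] in
/-- `crossCov` is homogeneous in the covariance. -/
theorem crossCov_smul (r : R) (C : Matrix Γ Γ R) : crossCov R (r • C) = r • crossCov R C := by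
  rw [crossCov, crossCov, dblCov_smul, dblCov_smul, smul_add]

omit [Fintype Γ] [DecidableEq Γ] [Algebra ℚ R] in
/-- `crossCov 0 = 0`. -/
theorem crossCov_zero : crossCov R (0 : Matrix Γ Γ R) = 0 := by
  have h := crossCov_smul R (0 : R) (0 : Matrix Γ Γ R)
  rwa [zero_smul, zero_smul] at h

omit [DecidableEq Γ] in
/-- **The cross Laplacian is additive in the covariance**: `Δ_×(C + D) = Δ_×(C) + Δ_×(D)`. -/
theorem grassmannLaplacian_crossCov_add (C D : Matrix Γ Γ R) :
    grassmannLaplacian R (crossCov R (C + D)) = grassmannLaplacian R (crossCov R C) + grassmannLaplacian R (crossCov R D) := by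
  rw [crossCov_add, grassmannLaplacian_add]

omit [DecidableEq Γ] in
/-- **The two-line binomial**: `Δ_×(D+g)² − Δ_×(D)² = Δ_×(g)² + Δ_×(g)∘Δ_×(D) + Δ_×(D)∘Δ_×(g)` — the second-order part of
`e^{Δ_×(D+g)} − e^{Δ_×(D)}` carries the line pairs `g⊗g`, `g⊗D`, `D⊗g` and no `D⊗D`. -/
theorem grassmannLaplacian_crossCov_add_sq (D g : Matrix Γ Γ R) :
    grassmannLaplacian R (crossCov R (D + g)) ^ 2 - grassmannLaplacian R (crossCov R D) ^ 2 =
      grassmannLaplacian R (crossCov R g) ^ 2 +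
        grassmannLaplacian R (crossCov R g) * grassmannLaplacian R (crossCov R D) +
          grassmannLaplacian R (crossCov R D) * grassmannLaplacian R (crossCov R g) := by
  rw [grassmannLaplacian_crossCov_add, sq, sq, sq, add_mul, mul_add, mul_add]
  abel

omit [DecidableEq Γ] in
/-- The same with the two mixed products merged (the cross Laplacians commute): `= Δ_×(g)² + 2·Δ_×(g)∘Δ_×(D)`. -/
theorem grassmannLaplacian_crossCov_add_sq' (D g : Matrix Γ Γ R) :
    grassmannLaplacian R (crossCov R (D + g)) ^ 2 - grassmannLaplacian R (crossCov R D) ^ 2 =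
      grassmannLaplacian R (crossCov R g) ^ 2 + 2 * (grassmannLaplacian R (crossCov R g) * grassmannLaplacian R (crossCov R D)) := by
  rw [grassmannLaplacian_crossCov_add_sq, (commute_grassmannLaplacian R (crossCov R D) (crossCov R g)).eq, two_mul]
  abel

end Generic

/-! ## §3 The model reading: the rung pairs of step `n + 1` -/

section Model

variable (L M : ℕ) [NeZero L] [NeZero M] (β U μ : ℝ) (K : TrigPolyC4v)

omit [NeZero M] in
/-- **`klw_rung_pairs`** — the two-line part of the step-`(n+1)` Wick term carries exactly the line pairs
`g_{n+1}⊗g_{n+1} + g_{n+1}⊗D_{n+1} + D_{n+1}⊗g_{n+1}` (the FULL particle–particle rung: same slice + softer partner), no `D⊗D`: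
`Δ_×(D_n)² − Δ_×(D_{n+1})² = Δ_×(g)² + Δ_×(g)∘Δ_×(D_{n+1}) + Δ_×(D_{n+1})∘Δ_×(g)`. -/
theorem klw_rung_pairs (n : ℕ) :
    grassmannLaplacian ℂ (crossCov ℂ (klSoftCov L M β μ K n)) ^ 2 -
        grassmannLaplacian ℂ (crossCov ℂ (klSoftCov L M β μ K (n + 1))) ^ 2 =
      grassmannLaplacian ℂ (crossCov ℂ (klSliceCov L M β μ K (n + 1))) ^ 2 +
        grassmannLaplacian ℂ (crossCov ℂ (klSliceCov L M β μ K (n + 1))) *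
            grassmannLaplacian ℂ (crossCov ℂ (klSoftCov L M β μ K (n + 1))) +
          grassmannLaplacian ℂ (crossCov ℂ (klSoftCov L M β μ K (n + 1))) *
            grassmannLaplacian ℂ (crossCov ℂ (klSliceCov L M β μ K (n + 1))) := by
  rw [klw_softCov_eq_succ_add_slice L M β μ K n]
  exact grassmannLaplacian_crossCov_add_sq ℂ _ _

end Model

end Summit.HubbardSuperconductivity.HubbardSuperconductivity.Theorems.KLRegimeWick

end
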